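/-
Copyright (c) 2026. All rights reserved.
Released under Apache 2.0 license as described in the file LICENSE.
Authors: abc-iut cell, prover seat abc-iut-L4-t5 (gen 9), over abc-iut-w6-d025's product / two-sided setting
(`LogFrobeniusSettingProd.lean`), abc-iut-f-102's THEOREM B (`LogFrobeniusRealisesSufficiency.lean`,
`LogFrobeniusGenuineCor55ShiftAction.lean`) and abc-iut-L4-t3's add-on laws `IotaOver` / `LamOverLink`.
-/
import Literature.AnabelianGeometry.AbsoluteAnabelian.LogFrobeniusSettingProdObservables
import Literature.AnabelianGeometry.AbsoluteAnabelian.LogFrobeniusGenuineCor55ShiftAction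
import HarnessLib

/-!
# [AbsTopIII] Corollary 5.5 (i)/(iii)/(v) at the PRODUCT of two settings and at the TWO-SIDED genuine setting: F-0159
# (`RealisesCor55Families`), F-0157 (`Cor55ShiftAction`), F-0156 decided — genuine nonarchimedean AND archimedean rows in ONE term

S. Mochizuki, *Topics in absolute anabelian geometry III*, J. Math. Sci. Univ. Tokyo 22 (2015) [MochizukiAbsTopIII2015];
manuscript `paper:url-5493eb38cbb7`: Def 5.4 (iv) pp. 126–127 and (vii) p. 128 ("lies over `Th•[Z]`"), Cor 5.5 (i) p. 130,
(iii) p. 131, (v) pp. 131–133 (the `ℤ`-action by nexus-classes of self-equivalences; proof p. 133 "the total `□`-rigidity in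
question follows immediately from the fact that `𝒳` is id-rigid"), Cor 5.5 p. 130 (the space-link / post-log proviso).

PROOF-ONLY companion (theorems only; nothing restated), continuing `LogFrobeniusSettingProdObservables.lean` (Cor 5.5 (iii)
both halves, (iv) every sentence at `genuineTwoSided p 𝔄`).  abc-iut-f-102's THEOREM B (`cor55ShiftAction_of_iotaOver`: from
the `ι⊞`-square condition, the `ι⊞` over `Th•[Z]` componentwise (`hpre`) and the space-link/post-log link (`hpost`), over a
nonempty `V(F_mod)`, ONE family on `D•⊢` realises Cor 5.5 (i)/(iii) and the `ℤ`-action clause of Cor 5.5 (v) holds) is fired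
at a PRODUCT of settings:

* `prod_toE_forget_iota_heq_of_preLog` / `_spaceLink` — THEOREM B's component hypotheses `hpre` / `hpost` for `L₁.prod L₂`
  from abc-iut-L4-t3's add-on laws `IotaOver`, `LamOverLink` on BOTH factors (componentwise, via
  `IotaOver.toE_map_iota_heq_of_preLog` / `toE_map_iota_heq_spaceLink`);
* ★ `prod_realises_and_cor55ShiftAction` — F-0159 ∧ F-0157 at `L₁.prod L₂` from {`IotaSquaresCommute`, `IotaOver`,
  `LamOverLink`} on both factors (`prod_iotaSquaresCommute` of the companion file); `prod_cor55Rigidity_iff` — F-0156 at the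
  product ⟺ `IsIdRigid (𝒳₁ × 𝒳₂)`;
* at `genuineTwoSided p 𝔄 := (nonarchGenuineMonoAnPf p).prod (archGenuineMonoAnChart 𝔄)` (BOTH place types genuine in one term):
  `nonarchGenuineMonoAnPf_iotaOver` / `_lamOverLink`, `archGenuineMonoAnChart_iotaOver` / `_lamOverLink` (holomorphic rows =
  `nonarchGenuine p`'s / `archGenuine 𝔄`'s, whose laws are abc-iut-L4-t3/f-102 lineage theorems), ★
  `genuineTwoSided_realises_and_cor55ShiftAction`, `genuineTwoSided_cor55ShiftAction` (F-0157), `…_exists_realisesCor55Families`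
  (F-0159), `genuineTwoSided_cor55ShiftAction_iff : … ↔ Nonempty V(F_mod)`, `genuineTwoSided_cor55Rigidity_iff_isIdRigid`
  (F-0156 ⟺ `IsIdRigid (𝒞^{MLF}_p × 𝒞^hol_TF)`), and ★ `genuineTwoSided_cor55_cluster` — Cor 5.5 (i) cores, (ii) telecore,
  (iii) `S_log⊞`/`S_log` (every `TS`-datum), (iii)+(i) realised in one family, (v) `ℤ`-action, and (iv) every typed sentence,
  ALL AT ONE setting genuine at both place types (binders: `V(F_mod) ≠ ∅`, an archimedean place `v₀`, an object `x₀`).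

MODEL-LEVEL; honest limits P1–P3 of `LogFrobeniusSettingProd.lean` persist (two-factor proxy of `Th•_T[Z]`, filler slots, factor
limits); Cor 5.5 (v)'s total `□`-rigidity is NOT claimed at the bare two-sided carrier (it is equivalent to id-rigidity of the
product carrier, `genuineTwoSided_cor55Rigidity_iff_isIdRigid`; the bare MLF model is not id-rigid, abc-iut-w4-d020).  Refereed
pre-IUT material; nothing here bears on [IUTchIII] Cor. 3.12; OUR kernel check, no side taken; non-vacuity ≠ endorsement.
-/

set_option autoImplicit false

open CategoryTheory

universe u

namespace Literature.AnabelianGeometry.AbsoluteAnabelian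

namespace LogFrobeniusSetting

variable {Vmod : Type u} {isArc : Vmod → Bool} (L₁ L₂ : LogFrobeniusSetting Vmod isArc)

/-! ## THEOREM B's component hypotheses for a product -/

/-- Transport for the component computations below: an `eqToHom` prefix inside two functor applications does not change
the heterogeneous class. [folklore] -/
private theorem heq_map_map_eqToHom_comp {A B C : Type*} [Category A] [Category B] [Category C] (F : A ⥤ B) (G : B ⥤ C)
    {a a' b : A} (e : a = a') (f : a' ⟶ b) {c d : C} {g : c ⟶ d} (h : HEq (G.map (F.map f)) g) :
    HEq (G.map (F.map (eqToHom e ≫ f))) g := by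
  subst e
  simpa using h

/-- `HEq` of morphisms of a product category from object equations and componentwise `HEq`. [folklore] -/
private theorem heq_of_heq_fst_snd {C D : Type*} [Category C] [Category D] {A B A' B' : C × D} {m : A ⟶ B}
    {n : A' ⟶ B'} (hA : A = A') (hB : B = B') (h₁ : HEq m.1 n.1) (h₂ : HEq m.2 n.2) : HEq m n := by
  subst hA hB
  exact heq_of_eq (Prod.hom_ext (eq_of_heq h₁) (eq_of_heq h₂))

/-- **`hpre` for a product**: along a PRE-log edge, the product's `ι⊞_{v,ε}` pushed down to `Th•[Z] × Th•[Z]` is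
`A_{ν₁} ∘ A_{ν₂}⁻¹` for the product over-structure `A := lamOver` — from `IotaOver` on both factors, componentwise.
[cite: MochizukiAbsTopIII2015, Def 5.4 (vii) p. 128] -/
theorem prod_toE_forget_iota_heq_of_preLog (hι₁ : L₁.IotaOver) (hι₂ : L₂.IotaOver) (v : Vmod)
    {ν₁ ν₂ : LogVertex (isArc v)} (ε : LogEdge (isArc v) ν₁ ν₂) (h₁ : ν₁.isPostLog = false) (X₀ : (L₁.prod L₂).X) :
    HEq (((L₁.prod L₂).toE v).map (((L₁.prod L₂).forget v).map (((L₁.prod L₂).iota v ε).app X₀)))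
      (((L₁.prod L₂).lamOver v ν₁).hom.app X₀ ≫ ((L₁.prod L₂).lamOver v ν₂).inv.app X₀) := by
  have k : ((frobeniusTwist (L₁.prod L₂).log ν₁.isPostLog ⋙ (L₁.prod L₂).lam v ν₁) ⋙ (L₁.prod L₂).forget v ⋙
        (L₁.prod L₂).toE v).obj X₀ = ((L₁.prod L₂).lam v ν₁ ⋙ (L₁.prod L₂).forget v ⋙ (L₁.prod L₂).toE v).obj X₀ := by
    rw [h₁]
    rfl
  apply heq_of_heq_fst_snd k rfl
  · change HEq ((L₁.toE v).map ((L₁.forget v).map (((L₁.prod L₂).iota v ε).app X₀).1)) _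
    rw [prod_iota_app_fst]
    exact heq_map_map_eqToHom_comp _ _ _ _ (hι₁.toE_map_iota_heq_of_preLog v ε h₁ X₀.1)
  · change HEq ((L₂.toE v).map ((L₂.forget v).map (((L₁.prod L₂).iota v ε).app X₀).2)) _
    rw [prod_iota_app_snd]
    exact heq_map_map_eqToHom_comp _ _ _ _ (hι₂.toE_map_iota_heq_of_preLog v ε h₁ X₀.2)

/-- **`hpost` for a product**: along the POST-log edge, the product's `ι⊞_{v,ε}` pushed down to `Th•[Z] × Th•[Z]` is
`A_{space-link, log X} ∘ Ξ_X ∘ A_{ν₂,X}⁻¹` (`Ξ := logOver`) — from `IotaOver` and `LamOverLink` on both factors.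
[cite: MochizukiAbsTopIII2015, Cor 5.5 p. 130] -/
theorem prod_toE_forget_iota_heq_spaceLink (hι₁ : L₁.IotaOver) (hΛ₁ : L₁.LamOverLink) (hι₂ : L₂.IotaOver)
    (hΛ₂ : L₂.LamOverLink) (v : Vmod) {ν₁ ν₂ : LogVertex (isArc v)} (ε : LogEdge (isArc v) ν₁ ν₂)
    (h₁ : ν₁.isPostLog = true) (X₀ : (L₁.prod L₂).X) :
    HEq (((L₁.prod L₂).toE v).map (((L₁.prod L₂).forget v).map (((L₁.prod L₂).iota v ε).app X₀)))
      (((L₁.prod L₂).lamOver v (LogVertex.spaceLink (isArc v))).hom.app ((L₁.prod L₂).log.obj X₀) ≫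
        (L₁.prod L₂).logOver.hom.app X₀ ≫ ((L₁.prod L₂).lamOver v ν₂).inv.app X₀) := by
  obtain rfl : ν₁ = LogVertex.postLog (isArc v) := LogVertex.eq_postLog_of_isPostLog _ h₁
  have k : ((frobeniusTwist (L₁.prod L₂).log (LogVertex.postLog (isArc v)).isPostLog ⋙
        (L₁.prod L₂).lam v (LogVertex.postLog (isArc v))) ⋙ (L₁.prod L₂).forget v ⋙ (L₁.prod L₂).toE v).obj X₀ =
      ((L₁.prod L₂).lam v (LogVertex.spaceLink (isArc v)) ⋙ (L₁.prod L₂).forget v ⋙ (L₁.prod L₂).toE v).obj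
        ((L₁.prod L₂).log.obj X₀) := by
    rw [h₁, (L₁.prod L₂).lam_spaceLink_eq_postLog v]
    rfl
  apply heq_of_heq_fst_snd k rfl
  · change HEq ((L₁.toE v).map ((L₁.forget v).map (((L₁.prod L₂).iota v ε).app X₀).1)) _
    rw [prod_iota_app_fst]
    exact heq_map_map_eqToHom_comp _ _ _ _ (hι₁.toE_map_iota_heq_spaceLink hΛ₁ v ε h₁ X₀.1)
  · change HEq ((L₂.toE v).map ((L₂.forget v).map (((L₁.prod L₂).iota v ε).app X₀).2)) _
    rw [prod_iota_app_snd]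
    exact heq_map_map_eqToHom_comp _ _ _ _ (hι₂.toE_map_iota_heq_spaceLink hΛ₂ v ε h₁ X₀.2)

/-! ## F-0159 / F-0157 / F-0156 at a product -/

/-- ★ **THEOREM B fired at a PRODUCT**: if in both factors the `ι⊞`-squares commute (Def 5.4 (iii)), the `ι⊞` lie over `Th•[Z]`
(`IotaOver`) and the space-link/post-log vertices carry one over-structure (`LamOverLink`), then over a nonempty `V(F_mod)` one
family on `D•⊢` of the product realises Cor 5.5 (i)/(iii) (F-0159) AND the `ℤ`-action clause of Cor 5.5 (v) holds (F-0157).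
[cite: MochizukiAbsTopIII2015, Cor 5.5 (v) pp. 131–133] -/
theorem prod_realises_and_cor55ShiftAction [Nonempty Vmod] (hsq₁ : ∀ v, L₁.IotaSquaresCommute v)
    (hsq₂ : ∀ v, L₂.IotaSquaresCommute v) (hι₁ : L₁.IotaOver) (hΛ₁ : L₁.LamOverLink) (hι₂ : L₂.IotaOver)
    (hΛ₂ : L₂.LamOverLink) :
    (∃ K : (L₁.prod L₂).diagram.HomotopyFamily, (L₁.prod L₂).RealisesCor55Families K) ∧ (L₁.prod L₂).Cor55ShiftAction :=
  (L₁.prod L₂).cor55ShiftAction_of_iotaOver (fun v => prod_iotaSquaresCommute L₁ L₂ v (hsq₁ v) (hsq₂ v))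
    (fun v _ _ ε h₁ _ X₀ => prod_toE_forget_iota_heq_of_preLog L₁ L₂ hι₁ hι₂ v ε h₁ X₀)
    (fun v _ _ ε h₁ _ X₀ => prod_toE_forget_iota_heq_spaceLink L₁ L₂ hι₁ hΛ₁ hι₂ hΛ₂ v ε h₁ X₀)

/-- **F-0156 (`Cor55Rigidity` = total `□`-rigidity ∧ `ℤ`-action) at such a product ⟺ the product carrier `𝒳₁ × 𝒳₂` is id-rigid**
(abc-iut-w5-d112's `cor55CoreRigid_iff` through abc-iut-f-102's `cor55Rigidity_iff_isIdRigid_and_exists`).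
[cite: MochizukiAbsTopIII2015, Cor 5.5 (v) p. 133] -/
theorem prod_cor55Rigidity_iff [Nonempty Vmod] (hsq₁ : ∀ v, L₁.IotaSquaresCommute v)
    (hsq₂ : ∀ v, L₂.IotaSquaresCommute v) (hι₁ : L₁.IotaOver) (hΛ₁ : L₁.LamOverLink) (hι₂ : L₂.IotaOver)
    (hΛ₂ : L₂.LamOverLink) : (L₁.prod L₂).Cor55Rigidity ↔ IsIdRigid (L₁.X × L₂.X) :=
  (L₁.prod L₂).cor55Rigidity_iff_isIdRigid_and_exists.trans
    ⟨fun h => h.1, fun h => ⟨h, (prod_realises_and_cor55ShiftAction L₁ L₂ hsq₁ hsq₂ hι₁ hΛ₁ hι₂ hΛ₂).1⟩⟩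

/-! ## At the two-sided genuine setting `genuineTwoSided p 𝔄` -/

section TwoSided

variable (p : ℕ) [Fact p.Prime] (𝔄 : AutHolFieldFunctor.{0}) (Vmod : Type 1) (isArc : Vmod → Bool)

/-- The `ι⊞` of the nonarchimedean factor lie over `Th•[Z]` (same holomorphic rows as `nonarchGenuine p`:
`nonarchGenuine_iotaOver`). [cite: MochizukiAbsTopIII2015, Def 5.4 (vii) p. 128] -/
theorem nonarchGenuineMonoAnPf_iotaOver : (nonarchGenuineMonoAnPf p Vmod isArc).IotaOver :=
  nonarchGenuine_iotaOver p Vmod isArc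

/-- The space-link/post-log link of the nonarchimedean factor (`nonarchGenuine_lamOverLink`).
[cite: MochizukiAbsTopIII2015, Cor 5.5 p. 130] -/
theorem nonarchGenuineMonoAnPf_lamOverLink : (nonarchGenuineMonoAnPf p Vmod isArc).LamOverLink :=
  nonarchGenuine_lamOverLink p Vmod isArc

/-- The `ι⊞` of the archimedean factor lie over `Th•[Z]` (same holomorphic rows as `archGenuine 𝔄`: `archGenuine_iotaOver`).
[cite: MochizukiAbsTopIII2015, Def 5.4 (vii) p. 128] -/
theorem archGenuineMonoAnChart_iotaOver : (archGenuineMonoAnChart 𝔄 Vmod isArc).IotaOver :=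
  archGenuine_iotaOver 𝔄 Vmod isArc

/-- The space-link/post-log link of the archimedean factor (`archGenuine_lamOverLink`). [cite: MochizukiAbsTopIII2015, Cor 5.5 p. 130] -/
theorem archGenuineMonoAnChart_lamOverLink : (archGenuineMonoAnChart 𝔄 Vmod isArc).LamOverLink :=
  archGenuine_lamOverLink 𝔄 Vmod isArc

/-- ★ **THEOREM B fired at the two-sided genuine setting**: over a nonempty `V(F_mod)`, one family on `D•⊢` of
`genuineTwoSided p 𝔄` realises Cor 5.5 (i)/(iii) (F-0159) and the `ℤ`-action clause of Cor 5.5 (v) holds (F-0157) — genuine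
nonarchimedean AND archimedean rows in one term; zero Prop hypotheses. [cite: MochizukiAbsTopIII2015, Cor 5.5 (v) pp. 131–133] -/
theorem genuineTwoSided_realises_and_cor55ShiftAction [Nonempty Vmod] :
    (∃ K : (genuineTwoSided p 𝔄 Vmod isArc).diagram.HomotopyFamily,
        (genuineTwoSided p 𝔄 Vmod isArc).RealisesCor55Families K) ∧
      (genuineTwoSided p 𝔄 Vmod isArc).Cor55ShiftAction :=
  prod_realises_and_cor55ShiftAction _ _ (nonarchGenuineMonoAnPf_iotaSquaresCommute p Vmod isArc)
    (archGenuineMonoAnChart_iotaSquaresCommute 𝔄 Vmod isArc) (nonarchGenuineMonoAnPf_iotaOver p Vmod isArc)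
    (nonarchGenuineMonoAnPf_lamOverLink p Vmod isArc) (archGenuineMonoAnChart_iotaOver 𝔄 Vmod isArc)
    (archGenuineMonoAnChart_lamOverLink 𝔄 Vmod isArc)

/-- **F-0159 at the two-sided genuine setting.** [cite: MochizukiAbsTopIII2015, Cor 5.5 (iii) p. 131] -/
theorem genuineTwoSided_exists_realisesCor55Families [Nonempty Vmod] :
    ∃ K : (genuineTwoSided p 𝔄 Vmod isArc).diagram.HomotopyFamily,
      (genuineTwoSided p 𝔄 Vmod isArc).RealisesCor55Families K :=
  (genuineTwoSided_realises_and_cor55ShiftAction p 𝔄 Vmod isArc).1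

/-- **F-0157 (Cor 5.5 (v), `ℤ`-action clause) at the two-sided genuine setting.** [cite: MochizukiAbsTopIII2015, Cor 5.5 (v) pp. 131–133] -/
theorem genuineTwoSided_cor55ShiftAction [Nonempty Vmod] : (genuineTwoSided p 𝔄 Vmod isArc).Cor55ShiftAction :=
  (genuineTwoSided_realises_and_cor55ShiftAction p 𝔄 Vmod isArc).2

/-- At the two-sided genuine setting F-0157 is EQUIVALENT to `V(F_mod) ≠ ∅` (necessity: abc-iut-f-102's
`nonempty_of_cor55ShiftAction`). [cite: MochizukiAbsTopIII2015, Cor 5.5 (v) pp. 131–133] -/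
theorem genuineTwoSided_cor55ShiftAction_iff :
    (genuineTwoSided p 𝔄 Vmod isArc).Cor55ShiftAction ↔ Nonempty Vmod :=
  ⟨fun h => (genuineTwoSided p 𝔄 Vmod isArc).nonempty_of_cor55ShiftAction h,
    fun _ => genuineTwoSided_cor55ShiftAction p 𝔄 Vmod isArc⟩

/-- **F-0156 at the two-sided genuine setting ⟺ the product carrier `𝒞^{MLF}_p × 𝒞^hol_TF` is id-rigid** (it is not claimed:
the bare MLF model carrier is not id-rigid, abc-iut-w4-d020; print's `𝒳 = 𝒞^{MLF-sB}` is the slim sub-model).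
[cite: MochizukiAbsTopIII2015, Cor 5.5 (v) p. 133] -/
theorem genuineTwoSided_cor55Rigidity_iff_isIdRigid [Nonempty Vmod] :
    (genuineTwoSided p 𝔄 Vmod isArc).Cor55Rigidity ↔ IsIdRigid (Up (AbsTopIII.TFModel p) × Up (HolTFPair 𝔄)) :=
  prod_cor55Rigidity_iff _ _ (nonarchGenuineMonoAnPf_iotaSquaresCommute p Vmod isArc)
    (archGenuineMonoAnChart_iotaSquaresCommute 𝔄 Vmod isArc) (nonarchGenuineMonoAnPf_iotaOver p Vmod isArc)
    (nonarchGenuineMonoAnPf_lamOverLink p Vmod isArc) (archGenuineMonoAnChart_iotaOver 𝔄 Vmod isArc)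
    (archGenuineMonoAnChart_lamOverLink 𝔄 Vmod isArc)

/-- ★ **The Cor 5.5 cluster at ONE setting genuine at BOTH place types** (binders: `V(F_mod) ≠ ∅`, an archimedean place `v₀`, an
object `x₀`; any `TS`-datum `T`): (i) the three cores (abc-iut-L4-t12's universal `cor55Cores_holds`), (ii) the telecore
`𝔗_{An•}` (abc-iut-L4-t15 lineage's `cor55Telecore_holds`), (iii) `S_log⊞` (F-0142) and `S_log` (F-3080, every `T`), (i)+(iii)
realised in ONE family (F-0159), (v) the `ℤ`-action (F-0157), (iv) every typed sentence (`Cor55Incompatibility`,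
`Cor55LogWall T`, `Cor55NotSimultaneouslyCompatible T`).  MODEL-LEVEL (two-factor proxy of the global theater).
[cite: MochizukiAbsTopIII2015, Cor 5.5 pp. 130–133] -/
theorem genuineTwoSided_cor55_cluster [Nonempty Vmod] (v₀ : Vmod) (hv₀ : isArc v₀ = true)
    (x₀ : (genuineTwoSided p 𝔄 Vmod isArc).X) (T : (genuineTwoSided p 𝔄 Vmod isArc).TSHomotopies) :
    (genuineTwoSided p 𝔄 Vmod isArc).Cor55Cores ∧ (genuineTwoSided p 𝔄 Vmod isArc).Cor55Telecore ∧
      (genuineTwoSided p 𝔄 Vmod isArc).Cor55Observables ∧ (genuineTwoSided p 𝔄 Vmod isArc).Cor55ObservablesTS T ∧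
      (∃ K : (genuineTwoSided p 𝔄 Vmod isArc).diagram.HomotopyFamily,
          (genuineTwoSided p 𝔄 Vmod isArc).RealisesCor55Families K) ∧
      (genuineTwoSided p 𝔄 Vmod isArc).Cor55ShiftAction ∧
      (genuineTwoSided p 𝔄 Vmod isArc).Cor55Incompatibility ∧ (genuineTwoSided p 𝔄 Vmod isArc).Cor55LogWall T ∧
      (genuineTwoSided p 𝔄 Vmod isArc).Cor55NotSimultaneouslyCompatible T :=
  ⟨(genuineTwoSided p 𝔄 Vmod isArc).cor55Cores_holds, (genuineTwoSided p 𝔄 Vmod isArc).cor55Telecore_holds,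
    genuineTwoSided_cor55Observables p 𝔄 Vmod isArc, genuineTwoSided_cor55ObservablesTS p 𝔄 Vmod isArc T,
    genuineTwoSided_exists_realisesCor55Families p 𝔄 Vmod isArc, genuineTwoSided_cor55ShiftAction p 𝔄 Vmod isArc,
    (genuineTwoSided_cor55iv_all p 𝔄 Vmod isArc v₀ hv₀ x₀).1, (genuineTwoSided_cor55iv_all p 𝔄 Vmod isArc v₀ hv₀ x₀).2 T⟩

end TwoSided

end LogFrobeniusSetting

end Literature.AnabelianGeometry.AbsoluteAnabelian
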